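import Literature.Geometry.Lorentzian.TeukolskyRadialFluxInfinity
import HarnessLib

/-!
# The energy flux of the scalar (`s = 0`) radial Teukolsky / Carter ODE, III:
# the flux pairing of the Wronskian and the diagonal of the Green kernel
# (Teixeira da Costa 2020, Prop. 2.20; DRSR 2014, §7.2 — elementary consequences)

Sequel of `TeukolskyRadialFlux.lean` / `TeukolskyRadialFluxInfinity.lean` (R. Teixeira da Costa,
Commun. Math. Phys. 378 (2020) 705–781 = arXiv:1910.02854 [Costa2019]; M. Dafermos–I. Rodnianski–
Y. Shlapentokh-Rothman, arXiv:1402.7034 [DafermosRodnianskiShlapentokhrothman2014]). There the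
conserved flux `F[R](r) = Δ(r)·Im(conj(R(r))·R′(r))` (`= Q^T[u]/ω`) of a classical solution of the
scalar radial ODE was computed on the normalised solutions of Def. 2.3: `F[R_𝓗] ≡ −(ω − mω₊)`,
`F[R_𝓘] ≡ ω`, whence `|𝔚(R_𝓗,R_𝓘)|² = |𝔚(R̄_𝓗,R_𝓘)|² + 4ω(ω − mω₊) ≥ 4ω(ω − mω₊)`.

This file records the POINTWISE companion of that identity — the pairing of the Wronskian
`𝔚 = Δ(R_𝓗 R_𝓘′ − R_𝓘 R_𝓗′)` (`Kerr.radialWronskian M a 0`) with the product `R_𝓗 R_𝓘` (the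
numerator of the Green kernel `G(r, r) = u_𝓗(r)u_𝓘(r)/𝔚` on the diagonal):

* `Costa2019.im_conj_mul_det` — the algebra `Im(conj(uv)·(uv′ − vu′)) = |u|²Im(v̄v′) − |v|²Im(ūu′)`;
* `Costa2019.im_conj_mul_radialWronskian` — hence, for ANY `R_𝓗, R_𝓘 : ℝ → ℂ` and any `r`,
  `Im(conj(R_𝓗(r)R_𝓘(r))·𝔚(r)) = |R_𝓗(r)|²·F[R_𝓘](r) − |R_𝓘(r)|²·F[R_𝓗](r)`;
* `Costa2019.im_conj_mul_radialWronskian_of_normalised` — for the normalised pair (`M > 0`,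
  `|a| < M`, `ω ≠ 0`, both classical solutions): **`Im(conj(R_𝓗 R_𝓘)·𝔚) = ω|R_𝓗|² + (ω − mω₊)|R_𝓘|²`**
  at every `r > r₊`;
* `Costa2019.abs_pairing_le_norm_mul_radialWronskian` —
  `|ω|R_𝓗|² + (ω − mω₊)|R_𝓘|²| ≤ |R_𝓗|·|R_𝓘|·|𝔚|` (`|Im z| ≤ |z|`);
* `Costa2019.diagKernel_le_of_nonSuperradiant_infinity` / `…_horizon` — for NON-SUPERRADIANT
  frequencies `ω(ω − mω₊) ≥ 0` the two terms have the same sign, so the diagonal kernel is bounded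
  by either factor ALONE: `|ω|·|R_𝓗||R_𝓘| ≤ |R_𝓘|²·|𝔚|` and `|ω − mω₊|·|R_𝓗||R_𝓘| ≤ |R_𝓗|²·|𝔚|`,
  i.e. `|G(r,r)| ≤ min(|u_𝓘(r)|²/|ω|, |u_𝓗(r)|²/|ω − mω₊|)·(r² + a²)⁻¹…` — no cancellation between
  the horizon solution and the infinity solution is possible on the diagonal, at ANY radius, with
  no asymptotic analysis (the Green-kernel form of "`𝔚 ≠ 0` for non-superradiant real `ω`",
  Prop. 2.20 ⇒ Thm 1.1 in that regime);
* `Costa2019.abs_sub_pairing_le_of_superradiant` — on the superradiant side `ω(ω − mω₊) ≤ 0`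
  only the DIFFERENCE is controlled: `||ω||R_𝓗|² − |ω − mω₊||R_𝓘|²| ≤ |R_𝓗||R_𝓘||𝔚|` (there
  `𝔚 = 0` is not excluded algebraically — it is excluded by the Whiting / Shlapentokh-Rothman /
  Teixeira da Costa mode-stability theorem).

In the logarithmic-derivative form these say `G(r,r)⁻¹ = u_𝓘′/u_𝓘 − u_𝓗′/u_𝓗` with
`Im(u_𝓘′/u_𝓘) = ω(r²+a²)…/|u_𝓘|² > 0 > Im(u_𝓗′/u_𝓗)` in the non-superradiant case (DRSR §7.2:
`Q^T = ω Im(u′ū)`). Everything is proved; theorems only; no differentiability is needed for the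
pointwise algebra (Mathlib's `deriv` enters only as a complex number).

## References
* R. Teixeira da Costa, CMP 378 (2020) = arXiv:1910.02854: Def. 2.3, §2.4.1, Proposition 2.20,
  Def. 5.1 (the Green kernel `u_𝓗(x_<)u_𝓘(x_>)/𝔚`), Remark 5.1. [Costa2019]
* M. Dafermos, I. Rodnianski, Y. Shlapentokh-Rothman, arXiv:1402.7034: §5 (Green's formula for
  Carter's ODE), §7.2 (`Q^T[u] = ω Im(u′ū)`). [DafermosRodnianskiShlapentokhrothman2014]
-/

noncomputable section

open Complex Set Filter Topology
open scoped ComplexConjugate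

namespace Literature.Geometry.Lorentzian.Kerr

namespace Costa2019

/-! ### The pairing identity -/

/-- `Im(conj(u v)·(u v′ − v u′)) = |u|²·Im(v̄ v′) − |v|²·Im(ū u′)` for complex numbers. [folklore] -/
theorem im_conj_mul_det (u u' v v' : ℂ) :
    (conj (u * v) * (u * v' - v * u')).im =
      ‖u‖ ^ 2 * (conj v * v').im - ‖v‖ ^ 2 * (conj u * u').im := by
  simp only [Complex.sq_norm, Complex.normSq_apply, map_mul, Complex.mul_re, Complex.mul_im,
    Complex.sub_re, Complex.sub_im, Complex.conj_re, Complex.conj_im]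
  ring

/-- **Flux pairing of the Wronskian** (`s = 0`, pointwise, any `R_𝓗, R_𝓘 : ℝ → ℂ`, any `r`):
`Im(conj(R_𝓗(r) R_𝓘(r))·𝔚(r)) = |R_𝓗(r)|²·(Δ Im(R̄_𝓘 R_𝓘′)) − |R_𝓘(r)|²·(Δ Im(R̄_𝓗 R_𝓗′))`, with
`𝔚 = Kerr.radialWronskian M a 0 R_𝓗 R_𝓘` and Mathlib's `deriv`. [cite: Costa2019, Proposition 2.20] -/
theorem im_conj_mul_radialWronskian (M a : ℝ) (RH RI : ℝ → ℂ) (r : ℝ) :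
    (conj (RH r * RI r) * radialWronskian M a 0 RH RI r).im =
      ‖RH r‖ ^ 2 * (delta M a r * (conj (RI r) * deriv RI r).im) -
        ‖RI r‖ ^ 2 * (delta M a r * (conj (RH r) * deriv RH r).im) := by
  rw [radialWronskian_apply, add_zero, Real.rpow_one]
  have e : conj (RH r * RI r) * (((delta M a r : ℝ) : ℂ) * (RH r * deriv RI r - RI r * deriv RH r)) =
      ((delta M a r : ℝ) : ℂ) * (conj (RH r * RI r) * (RH r * deriv RI r - RI r * deriv RH r)) := by
    ring
  rw [e, Complex.im_ofReal_mul, im_conj_mul_det]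
  ring

/-- **Flux pairing for the normalised pair** (`s = 0`, `M > 0`, `|a| < M`, `ω ≠ 0`): for `R_𝓗`
normalised at `𝓗⁺` and `R_𝓘` normalised at `𝓘⁺` (Def. 2.3), both classical solutions of the scalar
radial ODE, at every `r > r₊`:
`Im(conj(R_𝓗(r) R_𝓘(r))·𝔚(r)) = ω·|R_𝓗(r)|² + (ω − mω₊)·|R_𝓘(r)|²`
(insert `F[R_𝓘] = ω`, `F[R_𝓗] = −(ω − mω₊)`). [cite: Costa2019, Proposition 2.20] -/
theorem im_conj_mul_radialWronskian_of_normalised {M a ω m lam : ℝ} (hM : 0 < M) (ha : |a| < M)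
    (hω : ω ≠ 0) {RH RI : ℝ → ℂ} (hH : IsRadialTeukolskySolution M a 0 ω m lam RH)
    (hnH : IsNormalisedHorizonSolution M a 0 ω m RH) (hI : IsRadialTeukolskySolution M a 0 ω m lam RI)
    (hnI : IsNormalisedInfinitySolution M 0 ω RI) {r : ℝ} (hr : rPlus M a < r) :
    (conj (RH r * RI r) * radialWronskian M a 0 RH RI r).im =
      ω * ‖RH r‖ ^ 2 + (ω - m * horizonAngularVelocity M a) * ‖RI r‖ ^ 2 := by
  rw [im_conj_mul_radialWronskian, radialFlux_eq_of_normalisedInfinity hM ha hω hI hnI hr,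
    radialFlux_eq_of_normalisedHorizon ha hH hnH hr]
  ring

/-- **The pairing is bounded by the diagonal kernel numerator times `|𝔚|`**: for the normalised
pair as above, `|ω|R_𝓗(r)|² + (ω − mω₊)|R_𝓘(r)|²| ≤ |R_𝓗(r)|·|R_𝓘(r)|·|𝔚(r)|` (`|Im z| ≤ |z|`).
[cite: Costa2019, Proposition 2.20] -/
theorem abs_pairing_le_norm_mul_radialWronskian {M a ω m lam : ℝ} (hM : 0 < M) (ha : |a| < M)
    (hω : ω ≠ 0) {RH RI : ℝ → ℂ} (hH : IsRadialTeukolskySolution M a 0 ω m lam RH)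
    (hnH : IsNormalisedHorizonSolution M a 0 ω m RH) (hI : IsRadialTeukolskySolution M a 0 ω m lam RI)
    (hnI : IsNormalisedInfinitySolution M 0 ω RI) {r : ℝ} (hr : rPlus M a < r) :
    |ω * ‖RH r‖ ^ 2 + (ω - m * horizonAngularVelocity M a) * ‖RI r‖ ^ 2| ≤
      ‖RH r‖ * ‖RI r‖ * ‖radialWronskian M a 0 RH RI r‖ := by
  rw [← im_conj_mul_radialWronskian_of_normalised hM ha hω hH hnH hI hnI hr]
  calc |(conj (RH r * RI r) * radialWronskian M a 0 RH RI r).im|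
        ≤ ‖conj (RH r * RI r) * radialWronskian M a 0 RH RI r‖ := Complex.abs_im_le_norm _
    _ = ‖RH r‖ * ‖RI r‖ * ‖radialWronskian M a 0 RH RI r‖ := by
        rw [norm_mul, Complex.norm_conj, norm_mul]

/-! ### Non-superradiant frequencies: the diagonal kernel is bounded by either factor alone -/

/-- Same-sign bookkeeping: if `ω(ω − σ) ≥ 0`… stated abstractly: for `p q : ℝ` with `0 ≤ p·q` and
`x, y ≥ 0`, `|p x + q y| = |p| x + |q| y`. [folklore] -/
theorem abs_add_of_mul_nonneg {p q x y : ℝ} (hpq : 0 ≤ p * q) (hx : 0 ≤ x) (hy : 0 ≤ y) :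
    |p * x + q * y| = |p| * x + |q| * y := by
  rcases le_total 0 p with hp | hp
  · rcases hp.lt_or_eq with hp' | hp'
    · have hq : 0 ≤ q := nonneg_of_mul_nonneg_right hpq hp'
      rw [abs_of_nonneg hp, abs_of_nonneg hq, abs_of_nonneg (by positivity)]
    · subst hp'
      simp only [zero_mul, zero_add, abs_zero, abs_mul, abs_of_nonneg hy]
  · rcases hp.lt_or_eq with hp' | hp'
    · have hq : q ≤ 0 := by
        by_contra h
        push Not at h
        nlinarith [mul_neg_of_neg_of_pos hp' h]
      rw [abs_of_nonpos hp, abs_of_nonpos hq,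
        abs_of_nonpos (by nlinarith [mul_nonpos_of_nonpos_of_nonneg hp hx,
          mul_nonpos_of_nonpos_of_nonneg hq hy])]
      ring
    · subst hp'
      simp only [zero_mul, zero_add, abs_zero, abs_mul, abs_of_nonneg hy]

/-- **Non-superradiant pairing bound**: for the normalised pair and `ω(ω − mω₊) ≥ 0`,
`|ω|·|R_𝓗(r)|² + |ω − mω₊|·|R_𝓘(r)|² ≤ |R_𝓗(r)|·|R_𝓘(r)|·|𝔚(r)|` at every `r > r₊`.
[cite: Costa2019, Proposition 2.20] -/
theorem pairing_le_of_nonSuperradiant {M a ω m lam : ℝ} (hM : 0 < M) (ha : |a| < M)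
    (hω : ω ≠ 0) (hns : 0 ≤ ω * (ω - m * horizonAngularVelocity M a)) {RH RI : ℝ → ℂ}
    (hH : IsRadialTeukolskySolution M a 0 ω m lam RH) (hnH : IsNormalisedHorizonSolution M a 0 ω m RH)
    (hI : IsRadialTeukolskySolution M a 0 ω m lam RI) (hnI : IsNormalisedInfinitySolution M 0 ω RI)
    {r : ℝ} (hr : rPlus M a < r) :
    |ω| * ‖RH r‖ ^ 2 + |ω - m * horizonAngularVelocity M a| * ‖RI r‖ ^ 2 ≤
      ‖RH r‖ * ‖RI r‖ * ‖radialWronskian M a 0 RH RI r‖ := by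
  rw [← abs_add_of_mul_nonneg hns (sq_nonneg _) (sq_nonneg _)]
  exact abs_pairing_le_norm_mul_radialWronskian hM ha hω hH hnH hI hnI hr

/-- **Diagonal kernel bound by the infinity solution** (`s = 0`, non-superradiant `ω(ω − mω₊) ≥ 0`,
normalised pair): `|ω|·|R_𝓗(r)|·|R_𝓘(r)| ≤ |R_𝓘(r)|²·|𝔚(r)|` at every `r > r₊` — i.e. the Green
kernel on the diagonal obeys `|R_𝓗 R_𝓘/𝔚| ≤ |R_𝓘|²/|ω|` wherever `𝔚 ≠ 0`.
[cite: Costa2019, Proposition 2.20] -/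
theorem diagKernel_le_of_nonSuperradiant_infinity {M a ω m lam : ℝ} (hM : 0 < M) (ha : |a| < M)
    (hω : ω ≠ 0) (hns : 0 ≤ ω * (ω - m * horizonAngularVelocity M a)) {RH RI : ℝ → ℂ}
    (hH : IsRadialTeukolskySolution M a 0 ω m lam RH) (hnH : IsNormalisedHorizonSolution M a 0 ω m RH)
    (hI : IsRadialTeukolskySolution M a 0 ω m lam RI) (hnI : IsNormalisedInfinitySolution M 0 ω RI)
    {r : ℝ} (hr : rPlus M a < r) :
    |ω| * (‖RH r‖ * ‖RI r‖) ≤ ‖RI r‖ ^ 2 * ‖radialWronskian M a 0 RH RI r‖ := by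
  have h := pairing_le_of_nonSuperradiant hM ha hω hns hH hnH hI hnI hr
  set x := ‖RH r‖ with hx
  set y := ‖RI r‖ with hy
  set w := ‖radialWronskian M a 0 RH RI r‖ with hw
  have hx0 : 0 ≤ x := norm_nonneg _
  have hy0 : 0 ≤ y := norm_nonneg _
  have hw0 : 0 ≤ w := norm_nonneg _
  have h1 : |ω| * x ^ 2 ≤ x * y * w := by
    have : 0 ≤ |ω - m * horizonAngularVelocity M a| * y ^ 2 := by positivity
    linarith
  rcases hx0.lt_or_eq with hxpos | hx0'
  · -- divide by `x > 0`, multiply by `y ≥ 0`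
    have h2 : |ω| * x ≤ y * w := by
      have : x * (|ω| * x) ≤ x * (y * w) := by nlinarith
      exact le_of_mul_le_mul_left this hxpos
    calc |ω| * (x * y) = (|ω| * x) * y := by ring
      _ ≤ (y * w) * y := mul_le_mul_of_nonneg_right h2 hy0
      _ = y ^ 2 * w := by ring
  · rw [← hx0']
    simp only [zero_mul, mul_zero]
    positivity

/-- **Diagonal kernel bound by the horizon solution** (`s = 0`, non-superradiant `ω(ω − mω₊) ≥ 0`,
normalised pair): `|ω − mω₊|·|R_𝓗(r)|·|R_𝓘(r)| ≤ |R_𝓗(r)|²·|𝔚(r)|` at every `r > r₊` — i.e.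
`|R_𝓗 R_𝓘/𝔚| ≤ |R_𝓗|²/|ω − mω₊|` off the threshold `ω = mω₊`. [cite: Costa2019, Proposition 2.20] -/
theorem diagKernel_le_of_nonSuperradiant_horizon {M a ω m lam : ℝ} (hM : 0 < M) (ha : |a| < M)
    (hω : ω ≠ 0) (hns : 0 ≤ ω * (ω - m * horizonAngularVelocity M a)) {RH RI : ℝ → ℂ}
    (hH : IsRadialTeukolskySolution M a 0 ω m lam RH) (hnH : IsNormalisedHorizonSolution M a 0 ω m RH)
    (hI : IsRadialTeukolskySolution M a 0 ω m lam RI) (hnI : IsNormalisedInfinitySolution M 0 ω RI)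
    {r : ℝ} (hr : rPlus M a < r) :
    |ω - m * horizonAngularVelocity M a| * (‖RH r‖ * ‖RI r‖) ≤
      ‖RH r‖ ^ 2 * ‖radialWronskian M a 0 RH RI r‖ := by
  have h := pairing_le_of_nonSuperradiant hM ha hω hns hH hnH hI hnI hr
  set x := ‖RH r‖ with hx
  set y := ‖RI r‖ with hy
  set w := ‖radialWronskian M a 0 RH RI r‖ with hw
  set σ := |ω - m * horizonAngularVelocity M a| with hσ
  have hx0 : 0 ≤ x := norm_nonneg _
  have hy0 : 0 ≤ y := norm_nonneg _
  have hw0 : 0 ≤ w := norm_nonneg _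
  have hσ0 : 0 ≤ σ := abs_nonneg _
  have h1 : σ * y ^ 2 ≤ x * y * w := by
    have : 0 ≤ |ω| * x ^ 2 := by positivity
    linarith
  rcases hy0.lt_or_eq with hypos | hy0'
  · have h2 : σ * y ≤ x * w := by
      have : y * (σ * y) ≤ y * (x * w) := by nlinarith
      exact le_of_mul_le_mul_left this hypos
    calc σ * (x * y) = (σ * y) * x := by ring
      _ ≤ (x * w) * x := mul_le_mul_of_nonneg_right h2 hx0
      _ = x ^ 2 * w := by ring
  · rw [← hy0']
    simp only [mul_zero]
    positivity

/-- **Two-sided consequence** (non-superradiant, normalised pair): by the AM–GM inequality the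
pairing bound contains the flux lower bound of `TeukolskyRadialFluxInfinity`:
`2√(|ω||ω − mω₊|)·|R_𝓗||R_𝓘| ≤ |R_𝓗||R_𝓘||𝔚|`, in particular `2√(ω(ω − mω₊)) ≤ |𝔚|` wherever
`R_𝓗(r)R_𝓘(r) ≠ 0`. Recorded in the product-free form
`2·√(|ω|·|ω − mω₊|)·(|R_𝓗||R_𝓘|) ≤ |R_𝓗||R_𝓘|·|𝔚|`. [cite: Costa2019, Proposition 2.20] -/
theorem two_sqrt_mul_diag_le_of_nonSuperradiant {M a ω m lam : ℝ} (hM : 0 < M) (ha : |a| < M)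
    (hω : ω ≠ 0) (hns : 0 ≤ ω * (ω - m * horizonAngularVelocity M a)) {RH RI : ℝ → ℂ}
    (hH : IsRadialTeukolskySolution M a 0 ω m lam RH) (hnH : IsNormalisedHorizonSolution M a 0 ω m RH)
    (hI : IsRadialTeukolskySolution M a 0 ω m lam RI) (hnI : IsNormalisedInfinitySolution M 0 ω RI)
    {r : ℝ} (hr : rPlus M a < r) :
    2 * Real.sqrt (|ω| * |ω - m * horizonAngularVelocity M a|) * (‖RH r‖ * ‖RI r‖) ≤
      ‖RH r‖ * ‖RI r‖ * ‖radialWronskian M a 0 RH RI r‖ := by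
  have h := pairing_le_of_nonSuperradiant hM ha hω hns hH hnH hI hnI hr
  set x := ‖RH r‖ with hx
  set y := ‖RI r‖ with hy
  set p := |ω| with hp
  set q := |ω - m * horizonAngularVelocity M a| with hq
  have hx0 : 0 ≤ x := norm_nonneg _
  have hy0 : 0 ≤ y := norm_nonneg _
  have hp0 : 0 ≤ p := abs_nonneg _
  have hq0 : 0 ≤ q := abs_nonneg _
  -- AM–GM: `2√(pq)·xy ≤ p x² + q y²`
  have hamgm : 2 * Real.sqrt (p * q) * (x * y) ≤ p * x ^ 2 + q * y ^ 2 := by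
    have hs : Real.sqrt (p * q) = Real.sqrt p * Real.sqrt q := Real.sqrt_mul hp0 q
    rw [hs]
    nlinarith [sq_nonneg (Real.sqrt p * x - Real.sqrt q * y), Real.sq_sqrt hp0, Real.sq_sqrt hq0,
      Real.sqrt_nonneg p, Real.sqrt_nonneg q]
  exact hamgm.trans h

/-! ### Superradiant frequencies: only the difference is controlled -/

/-- **Superradiant pairing bound**: for the normalised pair and `ω(ω − mω₊) ≤ 0` the two fluxes
have the same sign and the pairing controls only the difference,
`||ω|·|R_𝓗(r)|² − |ω − mω₊|·|R_𝓘(r)|²| ≤ |R_𝓗(r)|·|R_𝓘(r)|·|𝔚(r)|` (`r > r₊`): a small Wronskian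
forces `|ω||R_𝓗|² ≈ |ω − mω₊||R_𝓘|²` at EVERY radius (the shape of a real-frequency mode, excluded
by mode stability, not by this algebra). [cite: Costa2019, Proposition 2.20] -/
theorem abs_sub_pairing_le_of_superradiant {M a ω m lam : ℝ} (hM : 0 < M) (ha : |a| < M)
    (hω : ω ≠ 0) (hsr : ω * (ω - m * horizonAngularVelocity M a) ≤ 0) {RH RI : ℝ → ℂ}
    (hH : IsRadialTeukolskySolution M a 0 ω m lam RH) (hnH : IsNormalisedHorizonSolution M a 0 ω m RH)
    (hI : IsRadialTeukolskySolution M a 0 ω m lam RI) (hnI : IsNormalisedInfinitySolution M 0 ω RI)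
    {r : ℝ} (hr : rPlus M a < r) :
    |(|ω| * ‖RH r‖ ^ 2 - |ω - m * horizonAngularVelocity M a| * ‖RI r‖ ^ 2)| ≤
      ‖RH r‖ * ‖RI r‖ * ‖radialWronskian M a 0 RH RI r‖ := by
  have h := abs_pairing_le_norm_mul_radialWronskian hM ha hω hH hnH hI hnI hr
  set σ := ω - m * horizonAngularVelocity M a with hσ
  -- `ω` and `σ` have opposite (weak) signs: `|ω x + σ y| = ||ω| x − |σ| y|`
  have key : |ω * ‖RH r‖ ^ 2 + σ * ‖RI r‖ ^ 2| = |(|ω| * ‖RH r‖ ^ 2 - |σ| * ‖RI r‖ ^ 2)| := by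
    rcases le_total 0 ω with hω0 | hω0
    · have hσ0 : σ ≤ 0 := by
        rcases hω0.lt_or_eq with h' | h'
        · by_contra hc
          push Not at hc
          nlinarith [mul_pos h' hc]
        · exact absurd h'.symm hω
      rw [abs_of_nonneg hω0, abs_of_nonpos hσ0]
      ring_nf
    · have hωneg : ω < 0 := lt_of_le_of_ne hω0 hω
      have hσ0 : 0 ≤ σ := by nlinarith [hsr, hωneg]
      rw [abs_of_nonpos hω0, abs_of_nonneg hσ0]
      have : -ω * ‖RH r‖ ^ 2 - σ * ‖RI r‖ ^ 2 = -(ω * ‖RH r‖ ^ 2 + σ * ‖RI r‖ ^ 2) := by ring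
      rw [this, abs_neg]
  rw [← key]
  exact h

end Costa2019

end Literature.Geometry.Lorentzian.Kerr

end
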